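import Mathlib
import HarnessLib
import Summits.ResolutionOfSingularities.ResolutionOfSingularities.Theorems.WildQuotientsWildQuotientResolutionS1aOneShotKill

/-!
# S1a — (T2a V5) ABSTRACT ONE-SHOT KILL, TRIANGULAR HIT CLAUSE (`AbstractOneShotKillV5`, plan-1 SIG `W45cT2KillV5.lean` b42a3d6bd3a48005)

[OURS · L1 W4.5c · lead-1 g7; plan-1 ASSIGNMENT v10.5 (3), θ-LP census v2 §3 (s108_i25: the root is killed only by a TRIANGULAR hit)]
— NOT statements of the manuscript; counted 0; AI-level work, weaker than expert review. Crux stmt-ResolutionOfSingularities-17941, line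
`s1a-logminvertex` v6, stub `stub_winningStrategy` (producer side of `IsPrincipalCentreChart`).

* `priorIdeal g e i = (e, g_j : j < i)` (plan-1ʼs definition, verbatim);
* **`augmentationIdeal_eq_span_of_oneShotV5`** — `τ` an automorphism of `C`, `g : ι → C` over a FINITE LINEAR ORDER with `(g) = (1)`,
  gr-shift `τ x − x ∈ (ε e^δ)`, radical clause `ε g_i^N e^M ∈ I_τ`, and for every `i` a TRIANGULAR hit
  `y ≡ ε u g_i^k e^δ (mod (ε e^δ)·(e, g_{<i}))` with `y ∈ I_τ`, `u` a unit mod `(e, g_{<i})` ⇒ `I_τ = (ε e^δ)`.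
  Proof = V3 (`augmentationIdeal_eq_span_of_oneShot_shift`) with the LEAST `i` such that `g_i ∉ 𝔪`.
* `abstractOneShotKillV5` — the ∀-form of the SIG.
-/

set_option linter.dupNamespace false

noncomputable section

open Literature.AlgebraicGeometry.Resolution

namespace Summit.ResolutionOfSingularities.ResolutionOfSingularities.Theorems.WildQuotientResolution.S1.OneShotKill

universe u v

/-- The PRIOR ideal of index `i`: `(e, g_j : j < i)` (plan-1 SIG `W45cT2KillV5`). [OURS · L1 W4.5c] -/
def priorIdeal {C : Type u} [CommRing C] {ι : Type v} [Preorder ι] (g : ι → C) (e : C) (i : ι) : Ideal C :=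
  Ideal.span (insert e (g '' Set.Iio i))

/-- **(T2a V5) ABSTRACT ONE-SHOT KILL with triangular hits.** [OURS · L1 W4.5c] -/
theorem augmentationIdeal_eq_span_of_oneShotV5 {C : Type u} [CommRing C] (τ : C ≃+* C) {ι : Type v} [LinearOrder ι] [Finite ι]
    (g : ι → C) (δ : ℕ) (ε e : C)
    (hcov : Ideal.span (Set.range g) = ⊤)
    (hgr : ∀ x : C, τ x - x ∈ Ideal.span {ε * e ^ δ})
    (hrad : ∀ i, ∃ N M : ℕ, ε * g i ^ N * e ^ M ∈ augmentationIdeal τ)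
    (hhit : ∀ i, ∃ (y u : C) (k : ℕ), y ∈ augmentationIdeal τ ∧ IsUnit (Ideal.Quotient.mk (priorIdeal g e i) u) ∧
      y - ε * u * g i ^ k * e ^ δ ∈ Ideal.span {ε * e ^ δ} * priorIdeal g e i) :
    augmentationIdeal τ = Ideal.span {ε * e ^ δ} := by
  classical
  refine le_antisymm (augmentationIdeal_le_span τ _ hgr) ?_
  rw [Ideal.span_singleton_le_iff_mem]
  -- the conductor `J = (I_τ : ε e^δ)`
  let J : Ideal C := (augmentationIdeal τ).colon {ε * e ^ δ}
  have hJ : ∀ c : C, c ∈ J ↔ c * (ε * e ^ δ) ∈ augmentationIdeal τ := fun c => by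
    rw [Submodule.mem_colon_singleton, smul_eq_mul]
  by_contra he
  have hJtop : J ≠ ⊤ := by
    intro h
    have h1 : (1 : C) ∈ J := by rw [h]; trivial
    rw [hJ, one_mul] at h1
    exact he h1
  obtain ⟨𝔪, h𝔪, hJ𝔪⟩ := Ideal.exists_le_maximal J hJtop
  -- the LEAST `i` with `g i ∉ 𝔪`
  have hS : {i | g i ∉ 𝔪}.Nonempty := by
    by_contra hall
    rw [Set.not_nonempty_iff_eq_empty, Set.eq_empty_iff_forall_notMem] at hall
    have : Ideal.span (Set.range g) ≤ 𝔪 := by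
      rw [Ideal.span_le]; rintro _ ⟨i, rfl⟩; exact not_not.mp (hall i)
    rw [hcov, top_le_iff] at this
    exact h𝔪.ne_top this
  haveI : WellFoundedLT ι := Finite.to_wellFoundedLT
  obtain ⟨i, hi, hmin⟩ := wellFounded_lt.has_min {i | g i ∉ 𝔪} hS
  have hi : g i ∉ 𝔪 := hi
  have hprior : ∀ j, j < i → g j ∈ 𝔪 := fun j hj => not_not.mp fun hgj => hmin j hgj hj
  -- `e ∈ 𝔪` (else the radical clause puts a power of `g i` or of `e` into `𝔪`)
  have hem : e ∈ 𝔪 := by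
    by_contra hem
    obtain ⟨N, M, hNM⟩ := hrad i
    have hmem : g i ^ N * e ^ (max M δ - δ) ∈ J := by
      rw [hJ]
      have hpow : e ^ (max M δ - δ) * e ^ δ = e ^ (max M δ - M) * e ^ M := by
        rw [← pow_add, ← pow_add, Nat.sub_add_cancel (le_max_right M δ), Nat.sub_add_cancel (le_max_left M δ)]
      have : g i ^ N * e ^ (max M δ - δ) * (ε * e ^ δ) = e ^ (max M δ - M) * (ε * g i ^ N * e ^ M) := by
        calc g i ^ N * e ^ (max M δ - δ) * (ε * e ^ δ) = ε * g i ^ N * (e ^ (max M δ - δ) * e ^ δ) := by ring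
          _ = ε * g i ^ N * (e ^ (max M δ - M) * e ^ M) := by rw [hpow]
          _ = e ^ (max M δ - M) * (ε * g i ^ N * e ^ M) := by ring
      rw [this]
      exact Ideal.mul_mem_left _ _ hNM
    rcases h𝔪.isPrime.mem_or_mem (hJ𝔪 hmem) with h1 | h2
    · exact hi (h𝔪.isPrime.mem_of_pow_mem _ h1)
    · exact hem (h𝔪.isPrime.mem_of_pow_mem _ h2)
  -- the prior ideal lies in `𝔪`
  have hP : priorIdeal g e i ≤ 𝔪 := by
    rw [priorIdeal, Ideal.span_le]
    rintro x (rfl | ⟨j, hj, rfl⟩)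
    · exact hem
    · exact hprior j hj
  -- the triangular hit at `i`
  obtain ⟨y, u, k, hy, hu, hrel⟩ := hhit i
  obtain ⟨m, hm, hmeq⟩ := Ideal.mem_span_singleton_mul.mp hrel
  have hmemJ : u * g i ^ k + m ∈ J := by
    rw [hJ]
    have : (u * g i ^ k + m) * (ε * e ^ δ) = y := by
      have e1 : ε * e ^ δ * m = y - ε * u * g i ^ k * e ^ δ := hmeq
      linear_combination e1
    rw [this]
    exact hy
  have h1 : u * g i ^ k + m ∈ 𝔪 := hJ𝔪 hmemJ
  have h2 : u * g i ^ k ∈ 𝔪 := by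
    have := 𝔪.sub_mem h1 (hP hm)
    rwa [add_sub_cancel_right] at this
  have hu𝔪 : u ∈ 𝔪 := by
    rcases h𝔪.isPrime.mem_or_mem h2 with h3 | h3
    · exact h3
    · exact absurd (h𝔪.isPrime.mem_of_pow_mem _ h3) hi
  obtain ⟨v', hv'⟩ := hu.exists_right_inv
  obtain ⟨v, rfl⟩ := Ideal.Quotient.mk_surjective v'
  rw [← map_mul, ← map_one (Ideal.Quotient.mk (priorIdeal g e i)), Ideal.Quotient.eq] at hv'
  have h3 : u * v - 1 ∈ 𝔪 := hP hv'
  have h4 : (1 : C) ∈ 𝔪 := by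
    have := 𝔪.sub_mem (𝔪.mul_mem_right v hu𝔪) h3
    rwa [sub_sub_cancel] at this
  exact h𝔪.ne_top ((Ideal.eq_top_iff_one 𝔪).mpr h4)

/-- (T2a V5) in the ∀-form of plan-1's signature sheet (`KillV5Sig.AbstractOneShotKillV5`, b42a3d6bd3a48005). -/
theorem abstractOneShotKillV5 (C : Type u) [CommRing C] (τ : C ≃+* C) (ι : Type v) [LinearOrder ι] [Finite ι] (g : ι → C)
    (δ : ℕ) (ε e : C) (hcov : Ideal.span (Set.range g) = ⊤) (hgr : ∀ x : C, τ x - x ∈ Ideal.span {ε * e ^ δ})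
    (hrad : ∀ i, ∃ N M : ℕ, ε * g i ^ N * e ^ M ∈ augmentationIdeal τ)
    (hhit : ∀ i, ∃ (y u : C) (k : ℕ), y ∈ augmentationIdeal τ ∧ IsUnit (Ideal.Quotient.mk (priorIdeal g e i) u) ∧
      y - ε * u * g i ^ k * e ^ δ ∈ Ideal.span {ε * e ^ δ} * priorIdeal g e i) :
    augmentationIdeal τ = Ideal.span {ε * e ^ δ} :=
  augmentationIdeal_eq_span_of_oneShotV5 τ g δ ε e hcov hgr hrad hhit

end Summit.ResolutionOfSingularities.ResolutionOfSingularities.Theorems.WildQuotientResolution.S1.OneShotKill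

end
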